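import Literature.NumberTheory.EllipticCurves.SelmerGaloisAction
import Literature.NumberTheory.EllipticCurves.SelmerCorankProofs
import Literature.NumberTheory.EllipticCurves.DiscreteH1Equiv
import HarnessLib

/-!
# The action of `Aut(K/ℚ)` on `H¹(K, E)` and `H¹(K, E[p^∞])`; stability of the finite Selmer conditions

The `p^∞` (and full-points) companion of `Literature.NumberTheory.EllipticCurves.SelmerGaloisAction`
(which treats `H¹(K, E[n])`). For `E = W/ℚ`, a field `K ⊇ ℚ`, `σ ∈ Aut(K/ℚ)` and a lift `τ` of
`σ` to `K̄` (`IsLiftOfAut`):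

* `IsLiftOfAut.conjH1Points` — the automorphism `[f] ↦ [g ↦ τ f(τ⁻¹ g τ)]` of `H¹(K, E)`
  (compatible pair `(conjGalCMH, pointsMap)` of `SelmerGaloisAction`);
* `conjH1Points_mem_localRestrictionKer_iff` — **transport of the local condition**
  along a `σ`-semilinear isomorphism `θ : E ≃+* E'` of `K`-fields: `τ_* x` dies in `H¹(E', E)`
  iff `x` dies in `H¹(E, E)` (verbatim the argument of `conjAct_mem_selmerLocalKer_iff`, with
  `E(K̄)` in place of `E[n]`);
* `IsLiftOfAut.primaryTorsionMap`, `IsLiftOfAut.conjH1Primary` — the action on `E[p^∞]` and on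
  `H¹(K, E[p^∞])`, commuting with `H¹(K, E[p^∞]) → H¹(K, E)` (`primaryH1ToH1_conjH1Primary`),
  whence the transport of the `p^∞`-Selmer local condition
  (`conjH1Primary_mem_selmerLocalKerPrimary_iff`, through `selmerLocalKerPrimary_eq_comap`);
* `WeierstrassCurve.finSelmerGroupPInfty` — the classes of `H¹(K, E[p^∞])` satisfying the Selmer
  local condition at every *finite* place (`Sel_{p^∞}(E/K)` itself adds the infinite places), and
  **its stability under `Aut(K/ℚ)`** for a number field `K`
  (`conjH1Primary_mem_finSelmerGroupPInfty`, with the Galois transport of completions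
  `galAdicCompletionEquiv` of `Automorphic/GaloisActionPlaces`).

This is the `Gal(K/ℚ)`-module structure on `Sel_{p^∞}(E/K)` (up to the archimedean conditions)
entering Dokchitser–Dokchitser, Ann. of Math. 172 (2010), Lemma 4.14 (`X_p(E/F)` as a
`G`-representation). Everything here is proved.

## References

* T. Dokchitser, V. Dokchitser, Ann. of Math. 172 (2010), Lemma 4.14. [DokchitserDokchitserAnnals2010]
* B. H. Gross, LMS LNS 153 (1991), §5 (5.1). [GrossLMS1991]
* J. W. S. Cassels, A. Fröhlich (eds.), *Algebraic Number Theory* (1967), Ch. VII §1.1.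
  [CasselsFrohlichANT1967]
-/

noncomputable section

open scoped Classical

universe u

namespace Literature.NumberTheory.EllipticCurves

open GaloisRepresentations WeierstrassCurve CategoryTheory

/-! ## The action on `H¹(K, E)` and transport of the local condition -/

section Points

variable {K : Type u} [Field K] [CharZero K] (W : WeierstrassCurve ℚ)
variable {σ : K ≃ₐ[ℚ] K} {τ : AlgebraicClosure K ≃+* AlgebraicClosure K}

/-- The automorphism of `H¹(K, E)` induced by a lift `τ` of `σ ∈ Aut(K/ℚ)`:
`[f] ↦ [g ↦ τ f(τ⁻¹ g τ)]` (the map of the compatible pair `(conjGalCMH, pointsMap)`).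
Gross 1991, §5 (5.1); Serre, *Galois Cohomology*, I.§2.4. [cite: GrossLMS1991, §5 (5.1)] -/
def IsLiftOfAut.conjH1Points (hτ : IsLiftOfAut σ τ) :
    (W.baseChange K).galH1 →+ (W.baseChange K).galH1 :=
  resH1Hom hτ.conjGalCMH (hτ.pointsMap W) (hτ.pointsMap_smul W)

variable {E E' : Type u} [Field E] [Algebra K E] [Field E'] [Algebra K E'] [CharZero E] [CharZero E']
variable {θ : E ≃+* E'} {Θ : AlgebraicClosure E ≃+* AlgebraicClosure E'}

/-- The coefficient sides of the two composite pairs agree on all of `E(K̄)`: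
`ι' (τ P) = Θ (ι_E P)` for `ι' = Θ ι_E τ⁻¹` (the tree's
`pointsMapOfEmb_embOfLifts_comp_torsionMap` without the restriction to `E[n]`). [folklore] -/
theorem pointsMapOfEmb_embOfLifts_comp_pointsMap (hτ : IsLiftOfAut σ τ)
    (hθ : IsSemilinearRingEquiv σ θ) (hΘ : IsLiftOfRingEquiv θ Θ) :
    (pointsMapOfEmb (W.baseChange K) (embOfLifts hτ hθ hΘ)).comp (hτ.pointsMap W) =
      (localPointsMap W Θ).comp (pointsMap (W.baseChange K) E) := by
  ext R
  change pointsMapOfEmb (W.baseChange K) (embOfLifts hτ hθ hΘ) (hτ.pointsMap W R) =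
    localPointsMap W Θ (pointsMap (W.baseChange K) E R)
  change ((W.baseChange K).baseChange (AlgebraicClosure K)).toAffine.Point at R
  rcases R with _ | ⟨x, y, h⟩
  · exact (localPointsMap_zero W Θ).symm
  · change _ = localPointsMap W Θ (WeierstrassCurve.Affine.Point.map (W' := W.baseChange K)
      (closureEmb (K := K) E) (.some x y h))
    rw [WeierstrassCurve.Affine.Point.map_some, localPointsMap_some]
    exact Affine.Point.some_eq_some_of_eq
      (show Θ (closureEmb (K := K) E (τ.symm (τ x))) = _ by rw [RingEquiv.symm_apply_apply])
      (show Θ (closureEmb (K := K) E (τ.symm (τ y))) = _ by rw [RingEquiv.symm_apply_apply])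

/-- **Transport of the local condition along a `σ`-semilinear isomorphism.** For `E = W/ℚ`,
`σ ∈ Aut(K/ℚ)` with lift `τ`, and a `σ`-semilinear ring isomorphism `θ : E ≃+* E'` of
`K`-fields, a class `x ∈ H¹(K, E)` dies in `H¹(E, E)` iff `τ_* x` dies in `H¹(E', E)`: with the
embedding `ι' = Θ ι_E τ⁻¹` at `E'` (allowed by `localRestrictionKerOfEmb_eq_holds`) the pair
computing `(τ_* x)|_{E'}` is the pair computing `x|_E` followed by the isomorphism of pairs
induced by a lift `Θ` of `θ`, whose `H¹`-map is injective. (Cassels–Fröhlich, Ch. VII §1.1;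
the tree's `conjAct_mem_selmerLocalKer_iff` for `E[n]`.)
[cite: CasselsFrohlichANT1967, Ch. VII §1.1] -/
theorem conjH1Points_mem_localRestrictionKer_iff (hτ : IsLiftOfAut σ τ) (θ : E ≃+* E')
    (hθ : IsSemilinearRingEquiv σ θ) (x : (W.baseChange K).galH1) :
    hτ.conjH1Points W x ∈ (W.baseChange K).localRestrictionKer E' ↔
      x ∈ (W.baseChange K).localRestrictionKer E := by
  have hΘ : IsLiftOfRingEquiv θ (ringEquivLift θ) := isLiftOfRingEquiv_ringEquivLift θ
  set ι' := embOfLifts hτ hθ hΘ with hι'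
  rw [← localRestrictionKerOfEmb_eq_holds (W.baseChange K) E' ι']
  -- the two composite pairs and their `H¹` maps
  have hA := map_one_eq_comp_of_eq hτ.conjGalCMH (hτ.pointsMap W) (hτ.pointsMap_smul W)
    (resGalOfEmb ι') (pointsMapOfEmb (W.baseChange K) ι') (pointsMapOfEmb_smul _ ι')
    (Φ := hτ.conjGalCMH.comp (resGalOfEmb ι'))
    (Ψ := (pointsMapOfEmb (W.baseChange K) ι').comp (hτ.pointsMap W))
    (fun g P ↦ by
      simp only [AddMonoidHom.coe_comp, Function.comp_apply, ContinuousMonoidHom.comp_toFun]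
      rw [hτ.pointsMap_smul W]
      exact pointsMapOfEmb_smul _ ι' g _) rfl rfl
  have hB := map_one_eq_comp_of_eq (resGal (K := K) E) (pointsMap (W.baseChange K) E)
    (pointsMap_smul _ E) hΘ.conjGalCMH (localPointsMap W (ringEquivLift θ))
    (hΘ.localPointsMap_smul W)
    (Φ := (resGal (K := K) E).comp hΘ.conjGalCMH)
    (Ψ := (localPointsMap W (ringEquivLift θ)).comp (pointsMap (W.baseChange K) E))
    (fun g P ↦ by
      simp only [AddMonoidHom.coe_comp, Function.comp_apply, ContinuousMonoidHom.comp_toFun]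
      rw [← hΘ.localPointsMap_smul W]
      congr 1
      exact pointsMap_smul _ E _ _) rfl rfl
  have hAB := map_one_pair_congr (conjGalCMH_comp_resGalOfEmb_embOfLifts hτ hθ hΘ)
    (pointsMapOfEmb_embOfLifts_comp_pointsMap W hτ hθ hΘ)
    (fun g P ↦ by
      simp only [AddMonoidHom.coe_comp, Function.comp_apply, ContinuousMonoidHom.comp_toFun]
      rw [hτ.pointsMap_smul W]
      exact pointsMapOfEmb_smul _ ι' g _)
    (fun g P ↦ by
      simp only [AddMonoidHom.coe_comp, Function.comp_apply, ContinuousMonoidHom.comp_toFun]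
      rw [← hΘ.localPointsMap_smul W]
      congr 1
      exact pointsMap_smul _ E _ _)
  rw [hA, hB] at hAB
  -- conclude
  rw [localRestrictionKerOfEmb, mem_resKer_iff, localRestrictionKer, mem_resKer_iff,
    IsLiftOfAut.conjH1Points, resH1Hom]
  simp only [LinearMap.toAddMonoidHom_coe, ContinuousLinearMap.coe_coe]
  rw [← ConcreteCategory.comp_apply, hAB, ConcreteCategory.comp_apply]
  constructor
  · intro h
    apply IsLiftOfRingEquiv.map_injective W hΘ
    rw [h, map_zero]
  · intro h
    rw [h, map_zero]

end Points

/-! ## The action on `E[p^∞]` and on `H¹(K, E[p^∞])` -/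

section Primary

variable {K : Type u} [Field K] [CharZero K] (W : WeierstrassCurve ℚ) (p : ℕ)
variable {σ : K ≃ₐ[ℚ] K} {τ : AlgebraicClosure K ≃+* AlgebraicClosure K}

/-- The action of a lift `τ` on the `p`-primary torsion `E[p^∞] ⊆ E(K̄)` (a homomorphism
preserves `p`-power torsion). [folklore] -/
def IsLiftOfAut.primaryTorsionMap (hτ : IsLiftOfAut σ τ) :
    geomPrimaryTorsion (W.baseChange K) p →+ geomPrimaryTorsion (W.baseChange K) p :=
  ((hτ.pointsMap W).comp (geomPrimaryTorsion (W.baseChange K) p).subtype).codRestrict _ fun P ↦ by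
    obtain ⟨k, hk⟩ := AddCommGroup.mem_primaryComponent.mp P.2
    refine AddCommGroup.mem_primaryComponent.mpr ⟨k, ?_⟩
    rw [AddMonoidHom.coe_comp, AddSubgroup.coe_subtype, Function.comp_apply, ← map_nsmul, hk,
      map_zero]

/-- Unfolding `primaryTorsionMap` on underlying points. [folklore] -/
@[simp]
theorem IsLiftOfAut.coe_primaryTorsionMap (hτ : IsLiftOfAut σ τ)
    (P : geomPrimaryTorsion (W.baseChange K) p) :
    (hτ.primaryTorsionMap W p P : geomPoints (W.baseChange K)) = hτ.pointsMap W P :=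
  rfl

/-- Compatibility of the pair `(conjGalCMH, primaryTorsionMap)` (from `pointsMap_smul`).
[folklore] -/
theorem IsLiftOfAut.primaryTorsionMap_smul (hτ : IsLiftOfAut σ τ) (g : Field.absoluteGaloisGroup K)
    (P : geomPrimaryTorsion (W.baseChange K) p) :
    hτ.primaryTorsionMap W p (hτ.conjGalCMH g • P) = g • hτ.primaryTorsionMap W p P :=
  Subtype.ext (hτ.pointsMap_smul W g P)

/-- The automorphism of `H¹(K, E[p^∞])` induced by a lift `τ` of `σ ∈ Aut(K/ℚ)`
(the map of the compatible pair `(conjGalCMH, primaryTorsionMap)`); the `p^∞` companion of the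
tree's `IsLiftOfAut.conjH1` on `H¹(K, E[n])`. Gross 1991, §5 (5.1); Dokchitser–Dokchitser 2010,
Lemma 4.14 (the `G`-action on `Sel_{p^∞}(E/F)`). [cite: GrossLMS1991, §5 (5.1)] -/
def IsLiftOfAut.conjH1Primary (hτ : IsLiftOfAut σ τ) :
    galH1Primary (W.baseChange K) p →+ galH1Primary (W.baseChange K) p :=
  resH1Hom hτ.conjGalCMH (hτ.primaryTorsionMap W p) (hτ.primaryTorsionMap_smul W p)

/-- **The actions commute with `H¹(K, E[p^∞]) → H¹(K, E)`**: both composites are the map of the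
pair `(conjGalCMH, E[p^∞] ↪ E(K̄) → E(K̄))`. [folklore] -/
theorem primaryH1ToH1_conjH1Primary (hτ : IsLiftOfAut σ τ) (s : galH1Primary (W.baseChange K) p) :
    primaryH1ToH1 (W.baseChange K) p (hτ.conjH1Primary W p s) =
      hτ.conjH1Points W (primaryH1ToH1 (W.baseChange K) p s) := by
  rw [primaryH1ToH1, IsLiftOfAut.conjH1Primary, IsLiftOfAut.conjH1Points, resH1Hom_resH1Hom,
    resH1Hom_resH1Hom]
  exact congrFun (congrArg DFunLike.coe (resH1Hom_congr (by ext; rfl) (by ext; rfl) _ _)) s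

variable {E E' : Type u} [Field E] [Algebra K E] [Field E'] [Algebra K E'] [CharZero E] [CharZero E']

/-- **Transport of the `p^∞`-Selmer local condition**: for a `σ`-semilinear `θ : E ≃+* E'`,
`τ_* s` satisfies the Selmer condition at `E'` iff `s` satisfies it at `E` (the conditions are the
preimages of the `H¹(·, E)` conditions, `selmerLocalKerPrimary_eq_comap`).
[cite: CasselsFrohlichANT1967, Ch. VII §1.1] -/
theorem conjH1Primary_mem_selmerLocalKerPrimary_iff (hτ : IsLiftOfAut σ τ)
    (θ : E ≃+* E') (hθ : IsSemilinearRingEquiv σ θ) (s : galH1Primary (W.baseChange K) p) :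
    hτ.conjH1Primary W p s ∈ selmerLocalKerPrimary (W.baseChange K) E' p ↔
      s ∈ selmerLocalKerPrimary (W.baseChange K) E p := by
  rw [selmerLocalKerPrimary_eq_comap, selmerLocalKerPrimary_eq_comap, AddSubgroup.mem_comap,
    AddSubgroup.mem_comap, primaryH1ToH1_conjH1Primary]
  exact conjH1Points_mem_localRestrictionKer_iff W hτ θ hθ _

end Primary

/-! ## The finite Selmer conditions and their stability -/

section FinSelmer

open NumberField IsDedekindDomain Literature.NumberTheory.Automorphic

variable {K : Type u} [Field K] [NumberField K]

/-- The classes of `H¹(K, E[p^∞])` satisfying the Selmer local condition at every **finite**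
place of the number field `K` (so that `Sel_{p^∞}(E/K)` is this group cut down by the conditions
at the infinite places, `selmerGroupPInfty_eq_finSelmerGroupPInfty_inf`). A deliberate
dot-notation extension in Mathlib's `WeierstrassCurve` namespace, as `selmerGroupPInfty`.
Greenberg (1999), §2. [folklore] -/
def _root_.WeierstrassCurve.finSelmerGroupPInfty (W : WeierstrassCurve K) (p : ℕ) :
    AddSubgroup (galH1Primary W p) :=
  ⨅ v : HeightOneSpectrum (𝓞 K), selmerLocalKerPrimary W (v.adicCompletion K) p

/-- Membership in `finSelmerGroupPInfty`. [folklore] -/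
theorem _root_.WeierstrassCurve.mem_finSelmerGroupPInfty_iff (W : WeierstrassCurve K) (p : ℕ)
    (c : galH1Primary W p) :
    c ∈ W.finSelmerGroupPInfty p ↔
      ∀ v : HeightOneSpectrum (𝓞 K), c ∈ selmerLocalKerPrimary W (v.adicCompletion K) p := by
  simp only [WeierstrassCurve.finSelmerGroupPInfty, AddSubgroup.mem_iInf]

/-- `Sel_{p^∞}(E/K)` is `finSelmerGroupPInfty` cut down by the infinite conditions (definitional).
[folklore] -/
theorem _root_.WeierstrassCurve.selmerGroupPInfty_eq_finSelmerGroupPInfty_inf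
    (W : WeierstrassCurve K) (p : ℕ) :
    selmerGroupPInfty W p = W.finSelmerGroupPInfty p ⊓
      ⨅ w : InfinitePlace K, selmerLocalKerPrimary W w.Completion p :=
  rfl

/-- `Sel_{p^∞}(E/K) ≤ finSelmerGroupPInfty`. [folklore] -/
theorem _root_.WeierstrassCurve.selmerGroupPInfty_le_finSelmerGroupPInfty
    (W : WeierstrassCurve K) (p : ℕ) : selmerGroupPInfty W p ≤ W.finSelmerGroupPInfty p :=
  inf_le_left

variable (W : WeierstrassCurve ℚ) (p : ℕ) {σ : K ≃ₐ[ℚ] K}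
  {τ : AlgebraicClosure K ≃+* AlgebraicClosure K}

/-- **The finite Selmer conditions of `E = W/ℚ` over a number field `K` are stable under
`Aut(K/ℚ)`**: `τ_*` carries the condition at `σ⁻¹ v` to the condition at `v`
(`conjH1Primary_mem_selmerLocalKerPrimary_iff` with the Galois transport of completions
`galAdicCompletionEquiv σ : K_{σ⁻¹ v} ≃+* K_v`, which is `σ`-semilinear). This is the
`Gal(K/ℚ)`-stability of `Sel_{p^∞}(E/K)` away from the archimedean conditions
(Dokchitser–Dokchitser 2010, Lemma 4.14: `Sel_{p^∞}(E/F)` as a `G`-module).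
[cite: DokchitserDokchitserAnnals2010, Lemma 4.14] -/
theorem conjH1Primary_mem_finSelmerGroupPInfty (hτ : IsLiftOfAut σ τ)
    {s : galH1Primary (W.baseChange K) p} (hs : s ∈ (W.baseChange K).finSelmerGroupPInfty p) :
    hτ.conjH1Primary W p s ∈ (W.baseChange K).finSelmerGroupPInfty p := by
  rw [WeierstrassCurve.mem_finSelmerGroupPInfty_iff] at hs ⊢
  intro v'
  have h : σ • (σ⁻¹ • v') = v' := smul_inv_smul σ v'
  haveI : CharZero ((σ⁻¹ • v').adicCompletion K) :=
    charZero_of_injective_algebraMap (algebraMap K _).injective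
  haveI : CharZero (v'.adicCompletion K) :=
    charZero_of_injective_algebraMap (algebraMap K _).injective
  exact (conjH1Primary_mem_selmerLocalKerPrimary_iff W p hτ (galAdicCompletionEquiv (L := K) σ h)
    (isSemilinearRingEquiv_galAdicCompletionEquiv σ h) s).mpr (hs _)

end FinSelmer

end Literature.NumberTheory.EllipticCurves
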